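import Summits.QuantumFields.YangMills.Theorems.ReplicaVarianceTiltHeightChiSqLEmlDContinuous
import Literature.MathematicalPhysics.QuantumLattice.GaugeGroups

/-!
# Route `ReplicaVarianceTilt` — crux `HeightChiSqL` (stmt-QuantumFields-26133), toward the residual of `stub_acIntegrable`:
# the UNIFORM TANGENT FLOOR of the exp-mean-log fibre map on the closed guard (helper `--supports stmt-QuantumFields-26133`)

Width seat `ym-line-sfw-p2-w3` gen 21 (home cell `ym-idea-1`; R3 RECORD rung — no summit, no rung and no crux is proved here; the YM mass
gap is NOT proved by any of this).  Pure calculus / topology over Mathlib, the tree's `T4EMLTangentInjective` and `QuantumLattice.GaugeGroups`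
(compactness of `U(N)`); every declaration is [folklore].
* `isCompact_closedGuard` — `{(h, W) : hᵢ, W ∈ U(N), ‖hᵢ W* − 1‖ ≤ δ}` is compact; `isCompact_skewSphere` — `{X : Xᴴ = −X, ‖X‖ = 1}` is compact.
* `exists_uniform_tangent_floor` — for weights `cᵢ ≥ 0`, `Σ cᵢ < 1` and `δ < 1/2` there is `c₀ ∈ (0, 1]` with
  `c₀‖X‖ ≤ ‖emlD h c W (W X)‖` for ALL unitary `hᵢ, W` in the closed guard and all skew-Hermitian `X`: the pointwise tangent injectivity
  `T4EMLTangentInjective.emlD_tangent_injective` made UNIFORM by the joint continuity `HeightChiSqLEmlDContinuous.continuousOn_emlD_apply_mul`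
  and compactness (minimum of a positive continuous function on `closed guard × skew unit sphere`).
This discharges input (a) of `…HeightChiSqLHaarDominatedMatrix.haar_restrict_map_le_smul_of_matrix` for the guarded exp-mean-log fibre laws,
uniformly in the frozen holonomies.  WHAT IS LEFT for `stub_acIntegrable` (not here): input (b), a finite injectivity cover of the guard
uniform in `h` (uniform injectivity radius from joint strict differentiability of the cone extension + compactness), and the assembly through
`BlockAveragingEMLHaarAC` §2 (`coe_fibreCore_eq`) and `…HeightChiSqLOfFibreLawBound.stubText_of_fibreLawBound`.  No estimate of Bałaban's is used.
-/

noncomputable section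

open NormedSpace Set Filter Topology Function Metric

namespace Summit.QuantumFields.YangMills.Theorems.HeightChiSqLEmlDTangentFloor

open scoped Matrix Matrix.Norms.L2Operator
open Literature.MathematicalPhysics.QuantumFieldTheory.Balaban1983to89.T4EMLTangentInjective (emlD emlD_tangent_injective)
open Summit.QuantumFields.YangMills.Theorems.HeightChiSqLEmlDContinuous (continuousOn_emlD_apply_mul)

variable {m : Type*} [Fintype m] [DecidableEq m] [Nonempty m] {ι : Type*} [Fintype ι]

omit [Nonempty m] [Fintype ι] in
/-- The CLOSED GUARD `{(h, W) : hᵢ, W unitary, ‖hᵢ W* − 1‖ ≤ δ}` is compact (closed in the compact `U(N)^ι × U(N)`). [folklore] -/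
theorem isCompact_closedGuard (δ : ℝ) :
    IsCompact {p : (ι → Matrix m m ℂ) × Matrix m m ℂ |
      (∀ i, p.1 i ∈ Matrix.unitaryGroup m ℂ) ∧ p.2 ∈ Matrix.unitaryGroup m ℂ ∧ ∀ i, ‖p.1 i * star p.2 - 1‖ ≤ δ} := by
  have hU : IsCompact (Matrix.unitaryGroup m ℂ : Set (Matrix m m ℂ)) :=
    isCompact_iff_compactSpace.mpr Matrix.unitaryGroup.instCompactSpace
  have hbig : IsCompact ((Set.univ.pi fun _ : ι => (Matrix.unitaryGroup m ℂ : Set (Matrix m m ℂ))) ×ˢ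
      (Matrix.unitaryGroup m ℂ : Set (Matrix m m ℂ))) := (isCompact_univ_pi fun _ => hU).prod hU
  refine hbig.of_isClosed_subset ?_ ?_
  · rw [Set.setOf_and, Set.setOf_and]
    refine (IsClosed.inter ?_ (IsClosed.inter ?_ ?_))
    · rw [Set.setOf_forall]
      exact isClosed_iInter fun i => isClosed_unitary.preimage ((continuous_apply i).comp continuous_fst)
    · exact isClosed_unitary.preimage continuous_snd
    · rw [Set.setOf_forall]
      refine isClosed_iInter fun i => ?_
      have hc : Continuous fun p : (ι → Matrix m m ℂ) × Matrix m m ℂ => p.1 i * star p.2 :=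
        ((continuous_apply i).comp continuous_fst).mul (continuous_star.comp continuous_snd)
      exact isClosed_le (hc.sub continuous_const).norm continuous_const
  · rintro p ⟨h1, h2, -⟩
    exact ⟨fun i _ => h1 i, h2⟩

omit [Nonempty m] in
/-- The unit sphere of the skew-Hermitian matrices is compact. [folklore] -/
theorem isCompact_skewSphere :
    IsCompact {X : Matrix m m ℂ | Xᴴ = -X ∧ ‖X‖ = 1} := by
  haveI : ProperSpace (Matrix m m ℂ) := FiniteDimensional.proper ℝ (Matrix m m ℂ)
  have hs : IsCompact (sphere (0 : Matrix m m ℂ) 1) := isCompact_sphere 0 1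
  refine hs.of_isClosed_subset ?_ ?_
  · rw [Set.setOf_and]
    refine IsClosed.inter (isClosed_eq ?_ continuous_neg) (isClosed_eq continuous_norm continuous_const)
    exact continuous_id.matrix_conjTranspose
  · rintro X ⟨-, hX⟩
    exact mem_sphere_zero_iff_norm.mpr hX

/-- **THE UNIFORM TANGENT FLOOR OF THE EXP-MEAN-LOG FIBRE MAP.**  For weights `cᵢ ≥ 0` with `Σ cᵢ < 1` and a guard radius `δ < 1/2`
there is `c₀ ∈ (0, 1]` such that for ALL unitary `hᵢ`, `W` with `‖hᵢ W* − 1‖ ≤ δ` and every skew-Hermitian `X`,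
`c₀‖X‖ ≤ ‖emlD h c W (W X)‖` — the pointwise tangent injectivity `T4EMLTangentInjective.emlD_tangent_injective`, made UNIFORM by the joint
continuity of `emlD` (`HeightChiSqLEmlDContinuous.continuousOn_emlD_apply_mul`) and compactness of `closed guard × skew unit sphere`. [folklore] -/
theorem exists_uniform_tangent_floor (c : ι → ℝ) (hc0 : ∀ i, 0 ≤ c i) (hc1 : ∑ i, c i < 1) {δ : ℝ} (hδ : δ < 1 / 2) :
    ∃ c₀ : ℝ, 0 < c₀ ∧ c₀ ≤ 1 ∧ ∀ (h : ι → Matrix m m ℂ) (W : Matrix m m ℂ),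
      (∀ i, h i ∈ Matrix.unitaryGroup m ℂ) → W ∈ Matrix.unitaryGroup m ℂ → (∀ i, ‖h i * star W - 1‖ ≤ δ) →
        ∀ X : Matrix m m ℂ, Xᴴ = -X → c₀ * ‖X‖ ≤ ‖emlD h c W (W * X)‖ := by
  set P : Set ((ι → Matrix m m ℂ) × Matrix m m ℂ) := {p |
      (∀ i, p.1 i ∈ Matrix.unitaryGroup m ℂ) ∧ p.2 ∈ Matrix.unitaryGroup m ℂ ∧ ∀ i, ‖p.1 i * star p.2 - 1‖ ≤ δ} with hP
  set S : Set (Matrix m m ℂ) := {X | Xᴴ = -X ∧ ‖X‖ = 1} with hS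
  have hK : IsCompact (P ×ˢ S) := (isCompact_closedGuard (m := m) (ι := ι) δ).prod isCompact_skewSphere
  set f : ((ι → Matrix m m ℂ) × Matrix m m ℂ) × Matrix m m ℂ → ℝ := fun q => ‖emlD q.1.1 c q.1.2 (q.1.2 * q.2)‖ with hf
  -- continuity of `f` on the compact set
  have hdom : P ×ˢ S ⊆ {q : ((ι → Matrix m m ℂ) × Matrix m m ℂ) × Matrix m m ℂ | ∀ i, ‖q.1.1 i * star q.1.2 - 1‖ < 1} := by
    rintro q ⟨⟨-, -, hq⟩, -⟩ i
    exact lt_of_le_of_lt (hq i) (by linarith)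
  have hfc : ContinuousOn f (P ×ˢ S) := ((continuousOn_emlD_apply_mul (m := m) c).mono hdom).norm
  -- positivity of `f` on the compact set
  have hpos : ∀ q ∈ P ×ˢ S, 0 < f q := by
    rintro q ⟨⟨hh, hW, hg⟩, hX, hX1⟩
    refine lt_of_le_of_ne (norm_nonneg _) fun h0 => ?_
    have hzero : emlD q.1.1 c q.1.2 (q.1.2 * q.2) = 0 := norm_eq_zero.mp h0.symm
    have hX0 := emlD_tangent_injective hh hW (fun i => lt_of_le_of_lt (hg i) hδ) hc0 hc1 q.2 hX hzero
    rw [hX0, norm_zero] at hX1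
    exact zero_ne_one hX1
  -- the floor
  obtain hKe | hKne := (P ×ˢ S).eq_empty_or_nonempty
  · refine ⟨1, one_pos, le_rfl, fun h W hh hW hg X hX => ?_⟩
    by_cases hX0 : X = 0
    · simp [hX0]
    · exfalso
      have hn : ‖X‖ ≠ 0 := norm_ne_zero_iff.mpr hX0
      have hmem : ((h, W), ‖X‖⁻¹ • X) ∈ P ×ˢ S := by
        refine ⟨⟨hh, hW, hg⟩, ?_, ?_⟩
        · show (‖X‖⁻¹ • X)ᴴ = -(‖X‖⁻¹ • X)
          rw [Matrix.conjTranspose_smul, star_trivial, hX, smul_neg]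
        · show ‖‖X‖⁻¹ • X‖ = 1
          rw [norm_smul, norm_inv, norm_norm, inv_mul_cancel₀ hn]
      rw [hKe] at hmem
      exact hmem
  obtain ⟨q₀, hq₀, hmin⟩ := hK.exists_isMinOn hKne hfc
  refine ⟨min (f q₀) 1, lt_min (hpos q₀ hq₀) one_pos, min_le_right _ _, fun h W hh hW hg X hX => ?_⟩
  by_cases hX0 : X = 0
  · simp [hX0]
  have hn : ‖X‖ ≠ 0 := norm_ne_zero_iff.mpr hX0
  have hnpos : 0 < ‖X‖ := norm_pos_iff.mpr hX0
  have hmem : ((h, W), ‖X‖⁻¹ • X) ∈ P ×ˢ S := by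
    refine ⟨⟨hh, hW, hg⟩, ?_, ?_⟩
    · show (‖X‖⁻¹ • X)ᴴ = -(‖X‖⁻¹ • X)
      rw [Matrix.conjTranspose_smul, star_trivial, hX, smul_neg]
    · show ‖‖X‖⁻¹ • X‖ = 1
      rw [norm_smul, norm_inv, norm_norm, inv_mul_cancel₀ hn]
  have hle := hmin hmem
  -- `f ((h,W), X/‖X‖) = ‖emlD h c W (W X)‖ / ‖X‖`
  have hval : f ((h, W), ‖X‖⁻¹ • X) = ‖X‖⁻¹ * ‖emlD h c W (W * X)‖ := by
    show ‖emlD h c W (W * (‖X‖⁻¹ • X))‖ = _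
    rw [Matrix.mul_smul, map_smul, norm_smul, norm_inv, norm_norm]
  rw [Set.mem_setOf_eq, hval] at hle
  calc min (f q₀) 1 * ‖X‖ ≤ f q₀ * ‖X‖ := mul_le_mul_of_nonneg_right (min_le_left _ _) hnpos.le
    _ ≤ (‖X‖⁻¹ * ‖emlD h c W (W * X)‖) * ‖X‖ := mul_le_mul_of_nonneg_right hle hnpos.le
    _ = ‖emlD h c W (W * X)‖ := by field_simp

end Summit.QuantumFields.YangMills.Theorems.HeightChiSqLEmlDTangentFloor

end
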